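import Summits.AnomalousDissipation.AnomalousDissipation.Theorems.SolenoidalFractalHomogenisationLagrangianStepN1Assembly
import Summits.AnomalousDissipation.AnomalousDissipation.Theorems.SolenoidalFractalHomogenisationLagrangianStepEffectiveFrameEnergyLDissipation
import HarnessLib

/-!
# K1L_D (stmt-AnomalousDissipation-27980), `stub_Z7_alphaBetaR` (N1′)/(N1*′) ON ONE GRID WINDOW: from the enstrophy loss bound of the coarse
# propagator (ad-lit g29's R4′ `IsPropagator.loss_le_mul_enstrophy`) to the REGISTERED conjunct shape with an m-UNIFORM constant
# (helper, `--supports 27980 --as helper`; prover ad-k1loc-p3 g9)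

The registered (N1′) conjunct of `Z7Glue.cellInputs_alphaBeta_textR` reads, per window `[jR, s′]` (`τ = s′ − jR`, `ν = cellVisc (m+1)`, `c = gain`):
`∀ x : V2, IsWeaklyDivFree x → lossFwd (Um (jR) s′) x ≤ CN · (Σ_{k∈Sf} min 1 ((a(m+1)·(8π²‖k‖²·lo·(ν + c/ν)/N(m+1)²))·τ)·‖x̂ k‖² + tail)`
with `CN` chosen BEFORE the carrier `E` and the level `m`.  This file closes it from a loss bound of the ENSTROPHY shape
`lossFwd (Um (jR) s′) y ≤ Cz·Z(y)` for weakly solenoidal finite-enstrophy `y` (R4′, `Cz = 2|k̄_m·hi|·τ·e^{2·3·G·τ}`):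
* `X2_weight_eq_kappa` — the registered weight IS `min 1 (κ‖k‖²)` with `κ = 8π²·lo·τ·(a(ν+c/ν)/N²) = 8π²·lo·τ·k̄_m` (`LagrangianStep.kbar_eq_rate`);
* `windowConst_le` — `4·(Cz·4π²)/κ ≤ 4·(|hi|/lo)·e^{Cexp}` whenever `Cz ≤ 2·(k̄_m·|hi|)·τ·e^{Cexp}` (the `k̄_m·τ` CANCEL — this is why CN is m-uniform;
  `Cexp = 12·C′·θ₀` from `FrameForm.window_exponent_le` when `τ ≤ 2R`);
* **`N1R_window`** / **`N1R_window_adj`** — the (N1′)/(N1*′) conjuncts on the window with `CN = max 4 (4·(|hi|/lo)·e^{Cexp})`, from `N1Assembly.lossFwd_le_of_enstrophyLoss`.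
NOT (N1′) unconditionally (R4′ is the hypothesis `hR4`), not the stub, not K1L_D, not AD; rung F-D1.A0.
-/

set_option linter.dupNamespace false

noncomputable section

namespace Summit.AnomalousDissipation.AnomalousDissipation.Theorems.SolenoidalFractalHomogenisation.LagrangianStep.N1Assembly

open Literature.Analysis Literature.Analysis.FluidPDE Literature.Analysis.FunctionSpaces
open MeasureTheory Finset UnitAddTorus
open scoped InnerProductSpace ENNReal
open Literature.Analysis.FluidPDE.LatticeShear (LagrangianLatticeCarrier)
open Summit.AnomalousDissipation.AnomalousDissipation.Theorems.SolenoidalFractalHomogenisation.LagrangianStep.LossCurrency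
open Summit.AnomalousDissipation.AnomalousDissipation.Theorems.SolenoidalFractalHomogenisation.LagrangianStep.CellClauseMod

variable {k : ℕ}

/-- **The registered N-currency weight in `κ‖k‖²` form**: `(a·(8π²‖k‖²·lo·(ν+c/ν)/N²))·τ = (8π²·lo·τ·(a(ν+c/ν)/N²))·‖k‖²`. -/
theorem X2_weight_eq_kappa (E : LagrangianLatticeCarrier k) (m : ℕ) (lo c τ : ℝ) (k' : Fin 3 → ℤ) :
    (E.a (m + 1) * (8 * Real.pi ^ 2 * ‖Torus.latticeVec k'‖ ^ 2 * lo * (E.cellVisc (m + 1) + c / E.cellVisc (m + 1)) /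
        (E.N (m + 1) : ℝ) ^ 2)) * τ
      = (8 * Real.pi ^ 2 * lo * τ * (E.a (m + 1) * (E.cellVisc (m + 1) + c / E.cellVisc (m + 1)) / (E.N (m + 1) : ℝ) ^ 2))
        * ‖Torus.latticeVec k'‖ ^ 2 := by
  ring

/-- **The window constant is m-uniform**: with `κ = 8π²·lo·τ·k̄_m` and `Cz ≤ 2·(k̄_m·|hi|)·τ·e^{Cexp}`, `4·(Cz·4π²)/κ ≤ 4·(|hi|/lo)·e^{Cexp}`. -/
theorem windowConst_le {κbar lo hi τ Cz Cexp : ℝ} (hκbar : 0 < κbar) (hlo : 0 < lo) (hτ : 0 < τ)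
    (hCz : Cz ≤ 2 * (κbar * |hi|) * τ * Real.exp Cexp) :
    4 * (Cz * (4 * Real.pi ^ 2) / (8 * Real.pi ^ 2 * lo * τ * κbar)) ≤ 4 * (|hi| / lo) * Real.exp Cexp := by
  have hden : 0 < 8 * Real.pi ^ 2 * lo * τ * κbar := by positivity
  rw [mul_div_assoc', div_le_iff₀ hden]
  have hπ : 0 < Real.pi ^ 2 := by positivity
  have h1 : 4 * (Cz * (4 * Real.pi ^ 2)) ≤ 4 * ((2 * (κbar * |hi|) * τ * Real.exp Cexp) * (4 * Real.pi ^ 2)) := by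
    nlinarith [mul_le_mul_of_nonneg_right hCz (by positivity : (0:ℝ) ≤ 4 * Real.pi ^ 2)]
  refine h1.trans (le_of_eq ?_)
  field_simp
  ring

/-- **(N1′) ON ONE GRID WINDOW.**  `E` permissible with `gain = c`, `0 < lo`, window `[jR, s′]` with `τ = s′ − jR > 0`; `Um (jR) s′` a contraction
losing at most `Cz·Z(y)` on weakly solenoidal finite-enstrophy `y` (R4′), with `Cz ≤ 2·(k̄_m·|hi|)·τ·e^{Cexp}`.  Then for every weakly solenoidal
`x` the registered (N1′) conjunct holds on this window with `CN = max 4 (4·(|hi|/lo)·e^{Cexp})`. -/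
theorem N1R_window (E : LagrangianLatticeCarrier k) (hP : E.toFractalCarrierData.Permissible) (m : ℕ) {lo hi c : ℝ} (hlo : 0 < lo)
    (hgain : E.gain = c) {U : V2 →L[ℝ] V2} (hU : ∀ y, ‖U y‖ ≤ ‖y‖) {jR s' : ℝ} (hτ : jR < s') {Cz Cexp : ℝ}
    (hCz : Cz ≤ 2 * (E.kbar m * |hi|) * (s' - jR) * Real.exp Cexp)
    (hR4 : ∀ y : V2, Torus.IsWeaklyDivFree (⇑y : VF) → Torus.eGradNormSq (⇑y : VF) ≠ ⊤ →
      lossFwd U y ≤ Cz * (Torus.eGradNormSq (⇑y : VF)).toReal)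
    {Sf : Finset (Fin 3 → ℤ)} (hSf : ∀ k' ∈ Sf, -k' ∈ Sf) (x : V2) (hx : Torus.IsWeaklyDivFree (⇑x : VF)) :
    lossFwd U x ≤ max 4 (4 * (|hi| / lo) * Real.exp Cexp) *
      (∑ k' ∈ Sf, min 1 ((E.a (m + 1) * (8 * Real.pi ^ 2 * ‖Torus.latticeVec k'‖ ^ 2 * lo * (E.cellVisc (m + 1) + c / E.cellVisc (m + 1)) /
            (E.N (m + 1) : ℝ) ^ 2)) * (s' - jR)) * ‖mFourierCoeff (EuclideanSpace.complexify ∘ (⇑x : VF)) k'‖ ^ 2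
        + (‖x‖ ^ 2 - ∑ k' ∈ Sf, ‖mFourierCoeff (EuclideanSpace.complexify ∘ (⇑x : VF)) k'‖ ^ 2)) := by
  have hkbar : E.kbar m = E.a (m + 1) * (E.cellVisc (m + 1) + c / E.cellVisc (m + 1)) / (E.N (m + 1) : ℝ) ^ 2 := by
    rw [← hgain]; exact kbar_eq_rate E hP m
  have hκbar : 0 < E.kbar m := E.kbar_pos m
  set κ : ℝ := 8 * Real.pi ^ 2 * lo * (s' - jR) * E.kbar m with hκdef
  have hκ : 0 < κ := by rw [hκdef]; have := sub_pos.2 hτ; positivity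
  -- the registered weights are `min 1 (κ‖k‖²)`
  have hw : ∀ k' : Fin 3 → ℤ, (E.a (m + 1) * (8 * Real.pi ^ 2 * ‖Torus.latticeVec k'‖ ^ 2 * lo *
      (E.cellVisc (m + 1) + c / E.cellVisc (m + 1)) / (E.N (m + 1) : ℝ) ^ 2)) * (s' - jR) = κ * ‖Torus.latticeVec k'‖ ^ 2 := by
    intro k'; rw [X2_weight_eq_kappa, hκdef, hkbar]
  simp_rw [hw]
  -- the generic assembly, then the constant
  have h := lossFwd_le_of_enstrophyLoss hU hSf hκ x hx hR4
  have hX0 : 0 ≤ ∑ k' ∈ Sf, min 1 (κ * ‖Torus.latticeVec k'‖ ^ 2) * ‖mFourierCoeff (EuclideanSpace.complexify ∘ (⇑x : VF)) k'‖ ^ 2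
      + (‖x‖ ^ 2 - ∑ k' ∈ Sf, ‖mFourierCoeff (EuclideanSpace.complexify ∘ (⇑x : VF)) k'‖ ^ 2) :=
    add_nonneg (Finset.sum_nonneg fun k' _ => mul_nonneg (le_min zero_le_one (by positivity)) (sq_nonneg _))
      (sub_nonneg.2 (sum_coeff_sq_le_norm_sq x hSf))
  have hC : max 4 (4 * (Cz * (4 * Real.pi ^ 2) / κ)) ≤ max 4 (4 * (|hi| / lo) * Real.exp Cexp) :=
    max_le_max le_rfl (by rw [hκdef]; exact windowConst_le hκbar hlo (sub_pos.2 hτ) hCz)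
  exact h.trans (mul_le_mul_of_nonneg_right hC hX0)

/-- **(N1*′) ON ONE GRID WINDOW** — the adjoint twin (R4′ for the adjoint window map, `Torus.adjoint_propagator`). -/
theorem N1R_window_adj (E : LagrangianLatticeCarrier k) (hP : E.toFractalCarrierData.Permissible) (m : ℕ) {lo hi c : ℝ} (hlo : 0 < lo)
    (hgain : E.gain = c) {U : V2 →L[ℝ] V2} (hU : ∀ y, ‖U y‖ ≤ ‖y‖) {jR s' : ℝ} (hτ : jR < s') {Cz Cexp : ℝ}
    (hCz : Cz ≤ 2 * (E.kbar m * |hi|) * (s' - jR) * Real.exp Cexp)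
    (hR4 : ∀ y : V2, Torus.IsWeaklyDivFree (⇑y : VF) → Torus.eGradNormSq (⇑y : VF) ≠ ⊤ →
      lossAdj U y ≤ Cz * (Torus.eGradNormSq (⇑y : VF)).toReal)
    {Sf : Finset (Fin 3 → ℤ)} (hSf : ∀ k' ∈ Sf, -k' ∈ Sf) (y : V2) (hy : Torus.IsWeaklyDivFree (⇑y : VF)) :
    lossAdj U y ≤ max 4 (4 * (|hi| / lo) * Real.exp Cexp) *
      (∑ k' ∈ Sf, min 1 ((E.a (m + 1) * (8 * Real.pi ^ 2 * ‖Torus.latticeVec k'‖ ^ 2 * lo * (E.cellVisc (m + 1) + c / E.cellVisc (m + 1)) /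
            (E.N (m + 1) : ℝ) ^ 2)) * (s' - jR)) * ‖mFourierCoeff (EuclideanSpace.complexify ∘ (⇑y : VF)) k'‖ ^ 2
        + (‖y‖ ^ 2 - ∑ k' ∈ Sf, ‖mFourierCoeff (EuclideanSpace.complexify ∘ (⇑y : VF)) k'‖ ^ 2)) :=
  N1R_window E hP m hlo hgain (U := ContinuousLinearMap.adjoint U) (norm_adjoint_le hU) hτ hCz hR4 hSf y hy

end Summit.AnomalousDissipation.AnomalousDissipation.Theorems.SolenoidalFractalHomogenisation.LagrangianStep.N1Assembly

end
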